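import Summits.CriticalPhenomena.PercolationContinuityZ3.Theorems.FK.EdgeDensityDerivative
import Literature.Probability.LatticeModels.RandomClusterEdgeWeightsConditioning
import HarnessLib

/-!
# The Lipschitz bound in `p` for the edge-parameter random-cluster measure `φ^B_{𝐩,q}`, uniformly in the
# boundary condition (Grimmett 2006, Thm. (2.43) with Thm. (3.7))

Support file of the `fk-continuity` cell (FANOUT-PLAN.md row FO-09, `--supports stmt-CriticalPhenomena-4575`);
builds on p205010 (kernel theorem, internal audit signed; external expert review pending).  Companion of
`EdgeDensityDerivative.lean` (the abstract tilted-family bound `abs_tiltAvg_sub_tiltAvg_le` and its instance for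
the homogeneous measure `rcMeasure G p q B`).

Here the measure is the tree's edge-parameter random-cluster measure `rcMeasureW w q B` (Grimmett 2006, eq. (1.20);
`RandomClusterEdgeWeights.lean`) and the parameter `p` sits on a finite set `F` of edges only, the weights off `F` being
frozen at arbitrary values in `[0, 1]`.  In the tree's rendering of Grimmett's Thm. (3.7) / Lemma (4.13)
(`RandomClusterEdgeWeightsConditioning.lean`) a boundary condition `ξ` on the region `F` IS such a frozen weight vector
(`condWeights w F ξ`: `p` on `F`, `1` on the open edges of `ξ` off `F`, `0` on the closed ones), so the bound below is
the boundary-condition-uniform Lipschitz estimate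
`|φ^ξ_{F,p',q}(A) - φ^ξ_{F,p,q}(A)| ≤ |F| · |p' - p| / min{p(1-p), p'(1-p')}` for every `ξ`, every wired set `B`,
every `q > 0` and every event `A` (Grimmett 2006, Thm. (2.43): the tilting measure `μ` of eq. (2.42) absorbs the frozen
factors and `q^{k^B}`).

* `weight_eq_of_eq_on` — the product weight factorises as `p^{|F ∩ ω|} (1-p)^{|F ∖ ω|} × (off-`F` factor)`;
* `abs_rcMeasureW_real_sub_le` — two weight vectors equal off `F` and constant `p`, `p'` on `F`;
* `abs_rcMeasureW_condWeights_real_sub_le`, `abs_rcMeasureW_condWeights_real_sub_le_of_mem_Icc` — the boundary-condition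
  form (`condWeights`), with the margin version on `[δ, 1-δ]`.

## References

* G. Grimmett, *The Random-Cluster Model*, Springer 2006: §2.4 Thm. (2.43) eq. (2.44) (p. 40); Thm. (3.7) (p. 39);
  §1.4 eq. (1.20) (p. 15). [Grimmett2006]
-/

noncomputable section

namespace Summit.CriticalPhenomena.PercolationContinuityZ3.Theorems

namespace FK

open MeasureTheory Finset Literature.Probability.LatticeModels Literature.Probability.Percolation
open Literature.Probability.Percolation.BHK2006 (weight ind_le_one)
open Literature.Probability.Percolation.DecisionTree (ind ind_nonneg)
open scoped Classical

section EdgeWeights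

variable {V : Type*} [Fintype V]

/-- If the edge parameters equal `p` on `F`, the product weight `∏_e (w_e if e ∈ ω else 1 - w_e)` factorises as
`p^{|F ∩ ω|} (1-p)^{|F ∖ ω|} · ∏_{e ∉ F} (w_e if e ∈ ω else 1 - w_e)`. [folklore] -/
theorem weight_eq_of_eq_on {w : Sym2 V → ℝ} {F : Finset (Sym2 V)} {p : ℝ} (hw : ∀ e ∈ F, w e = p)
    (ω : BondConfig V) :
    weight w ω = p ^ #(F.filter (· ∈ ω)) * (1 - p) ^ #(F.filter (· ∉ ω)) *
      ∏ e ∈ Fᶜ, (if e ∈ ω then w e else 1 - w e) := by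
  unfold weight
  rw [← Finset.prod_mul_prod_compl F, Finset.prod_ite]
  congr 2
  · rw [Finset.prod_congr rfl fun e he => hw e (Finset.mem_filter.1 he).1, Finset.prod_const]
  · rw [Finset.prod_congr rfl fun e he => by rw [hw e (Finset.mem_filter.1 he).1], Finset.prod_const]

/-- The random-cluster weight for edge parameters equal to `p` on `F` is a member of the tilted family of
`EdgeDensityDerivative.lean`: `w^B_{𝐩,q}(ω) = p^{|F ∩ ω|} (1-p)^{|F ∖ ω|} μ(ω)` with
`μ(ω) = (∏_{e ∉ F} …) q^{k^B(ω)}` independent of `p`. [cite: Grimmett2006, §2.4 eq. (2.42) p. 40] -/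
theorem rcWeightW_eq_of_eq_on {w : Sym2 V → unitInterval} {F : Finset (Sym2 V)} {p : ℝ}
    (hw : ∀ e ∈ F, (w e : ℝ) = p) (q : ℝ) (B : Set V) (ω : BondConfig V) :
    rcWeightW w q B ω = p ^ #(F.filter (· ∈ ω)) * (1 - p) ^ #(F.filter (· ∉ ω)) *
      ((∏ e ∈ Fᶜ, (if e ∈ ω then (w e : ℝ) else 1 - w e)) * q ^ clusterCount ω B) := by
  unfold rcWeightW
  rw [weight_eq_of_eq_on hw ω]
  ring

/-- **Lipschitz continuity in the parameter of a region, uniformly in everything else** (Grimmett 2006, Thm. (2.43)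
for `φ^B_{𝐩,q}`): if two edge-parameter vectors `w, w'` agree off the finite edge set `F` and are constant, `p` resp.
`p'` in `(0, 1)`, on `F`, then for every `q > 0`, every wired set `B` and every event `A`,
`|φ^B_{w',q}(A) - φ^B_{w,q}(A)| ≤ |F| / min{p(1-p), p'(1-p')} · |p' - p|` — whatever the (frozen) parameters off `F`.
[cite: Grimmett2006, Thm. (2.43) eq. (2.44) p. 40] -/
theorem abs_rcMeasureW_real_sub_le {w w' : Sym2 V → unitInterval} {F : Finset (Sym2 V)} {p p' : ℝ}
    (hp : p ∈ Set.Ioo (0 : ℝ) 1) (hp' : p' ∈ Set.Ioo (0 : ℝ) 1) (hw : ∀ e ∈ F, (w e : ℝ) = p)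
    (hw' : ∀ e ∈ F, (w' e : ℝ) = p') (hoff : ∀ e, e ∉ F → w' e = w e) {q : ℝ} (hq : 0 < q) (B : Set V)
    (A : Set (BondConfig V)) :
    |(rcMeasureW w' q B).real A - (rcMeasureW w q B).real A| ≤
      #F / min (p * (1 - p)) (p' * (1 - p')) * |p' - p| := by
  -- both weights belong to the same tilted family
  have hμ' : ∀ ω : BondConfig V, (∏ e ∈ Fᶜ, (if e ∈ ω then (w' e : ℝ) else 1 - w' e)) =
      ∏ e ∈ Fᶜ, (if e ∈ ω then (w e : ℝ) else 1 - w e) := fun ω =>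
    Finset.prod_congr rfl fun e he => by rw [hoff e (Finset.mem_compl.1 he)]
  have hW : ∀ ω : BondConfig V, rcWeightW w q B ω = p ^ #(F.filter (· ∈ ω)) * (1 - p) ^ #(F.filter (· ∉ ω)) *
      ((∏ e ∈ Fᶜ, (if e ∈ ω then (w e : ℝ) else 1 - w e)) * q ^ clusterCount ω B) :=
    fun ω => rcWeightW_eq_of_eq_on hw q B ω
  have hW' : ∀ ω : BondConfig V, rcWeightW w' q B ω = p' ^ #(F.filter (· ∈ ω)) * (1 - p') ^ #(F.filter (· ∉ ω)) *
      ((∏ e ∈ Fᶜ, (if e ∈ ω then (w e : ℝ) else 1 - w e)) * q ^ clusterCount ω B) := fun ω => by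
    rw [rcWeightW_eq_of_eq_on hw' q B ω, hμ']
  rw [rcMeasureW_real_eq_sum_div w' hq B A, rcMeasureW_real_eq_sum_div w hq B A, rcPartitionFunctionW,
    rcPartitionFunctionW]
  simp only [hW, hW']
  refine abs_tiltAvg_sub_tiltAvg_le Finset.univ (a := fun ω : BondConfig V => #(F.filter (· ∈ ω)))
    (b := fun ω : BondConfig V => #(F.filter (· ∉ ω)))
    (μ := fun ω : BondConfig V => (∏ e ∈ Fᶜ, (if e ∈ ω then (w e : ℝ) else 1 - w e)) * q ^ clusterCount ω B)
    (N := #F) (ind A) (fun ω _ => Finset.card_filter_le _ _) (fun ω _ => Finset.card_filter_le _ _)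
    (fun ω _ => ?_) ?_ (fun ω _ => ⟨ind_nonneg A ω, ind_le_one A ω⟩) hp hp'
  · -- `μ ≥ 0`
    refine mul_nonneg (Finset.prod_nonneg fun e _ => ?_) (pow_nonneg hq.le _)
    split_ifs
    · exact (w e).2.1
    · exact sub_nonneg.2 (w e).2.2
  · -- `μ` has a positive entry: the configuration `{e | w_e > 1/2}`
    refine ⟨{e | (1 / 2 : ℝ) < w e}, Finset.mem_univ _, mul_pos (Finset.prod_pos fun e _ => ?_) (pow_pos hq _)⟩
    by_cases he : (1 / 2 : ℝ) < w e
    · rw [if_pos (show e ∈ {e | (1 / 2 : ℝ) < w e} from he)]; linarith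
    · rw [if_neg (show e ∉ {e | (1 / 2 : ℝ) < w e} from he)]; linarith [not_lt.1 he]

/-- **Boundary-condition-uniform Lipschitz continuity in `p`** (Grimmett 2006, Thm. (2.43), in the boundary-condition
language of Thm. (3.7) / Lemma (4.13) as rendered by the tree's `condWeights`): for a finite region `F` with parameter
`p` (resp. `p'`) on `F`, ANY configuration `ξ` off `F` acting as boundary condition (its edges frozen open, the others
frozen closed), any wired set `B`, any `q > 0` and any event `A`,
`|φ^{ξ,B}_{F,p',q}(A) - φ^{ξ,B}_{F,p,q}(A)| ≤ |F| / min{p(1-p), p'(1-p')} · |p' - p|`.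
[cite: Grimmett2006, Thm. (2.43) eq. (2.44) p. 40; Thm. (3.7) p. 39] -/
theorem abs_rcMeasureW_condWeights_real_sub_le {w w' : Sym2 V → unitInterval} {F : Finset (Sym2 V)} {p p' : ℝ}
    (hp : p ∈ Set.Ioo (0 : ℝ) 1) (hp' : p' ∈ Set.Ioo (0 : ℝ) 1) (hw : ∀ e ∈ F, (w e : ℝ) = p)
    (hw' : ∀ e ∈ F, (w' e : ℝ) = p') (ξ : Set (Sym2 V)) {q : ℝ} (hq : 0 < q) (B : Set V)
    (A : Set (BondConfig V)) :
    |(rcMeasureW (condWeights w' ↑F ξ) q B).real A - (rcMeasureW (condWeights w ↑F ξ) q B).real A| ≤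
      #F / min (p * (1 - p)) (p' * (1 - p')) * |p' - p| := by
  refine abs_rcMeasureW_real_sub_le hp hp' (fun e he => ?_) (fun e he => ?_) (fun e he => ?_) hq B A
  · rw [← hw e he]; simp [condWeights, he]
  · rw [← hw' e he]; simp [condWeights, he]
  · simp [condWeights, he]

/-- The margin form: for `p, p' ∈ [δ, 1-δ]`, `0 < δ`, and every boundary condition `ξ`, wired set `B`, `q > 0`, event `A`:
`|φ^{ξ,B}_{F,p',q}(A) - φ^{ξ,B}_{F,p,q}(A)| ≤ |F| / (δ(1-δ)) · |p' - p|` — the constant depends only on the number of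
edges of the region and on the margin, the form used to move `p` in every step of an exploration at once.
[cite: Grimmett2006, Thm. (2.43) eq. (2.44) p. 40; Thm. (3.7) p. 39] -/
theorem abs_rcMeasureW_condWeights_real_sub_le_of_mem_Icc {w w' : Sym2 V → unitInterval} {F : Finset (Sym2 V)}
    {δ p p' : ℝ} (hδ : 0 < δ) (hp : p ∈ Set.Icc δ (1 - δ)) (hp' : p' ∈ Set.Icc δ (1 - δ))
    (hw : ∀ e ∈ F, (w e : ℝ) = p) (hw' : ∀ e ∈ F, (w' e : ℝ) = p') (ξ : Set (Sym2 V)) {q : ℝ} (hq : 0 < q)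
    (B : Set V) (A : Set (BondConfig V)) :
    |(rcMeasureW (condWeights w' ↑F ξ) q B).real A - (rcMeasureW (condWeights w ↑F ξ) q B).real A| ≤
      #F / (δ * (1 - δ)) * |p' - p| := by
  have hpo : p ∈ Set.Ioo (0 : ℝ) 1 := ⟨hδ.trans_le hp.1, by linarith [hp.2]⟩
  have hpo' : p' ∈ Set.Ioo (0 : ℝ) 1 := ⟨hδ.trans_le hp'.1, by linarith [hp'.2]⟩
  refine (abs_rcMeasureW_condWeights_real_sub_le hpo hpo' hw hw' ξ hq B A).trans
    (mul_le_mul_of_nonneg_right ?_ (abs_nonneg _))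
  have hmin : δ * (1 - δ) ≤ min (p * (1 - p)) (p' * (1 - p')) :=
    le_min (by nlinarith [hp.1, hp.2]) (by nlinarith [hp'.1, hp'.2])
  exact div_le_div_of_nonneg_left (Nat.cast_nonneg _) (mul_pos hδ (by linarith [hp.1.trans hp.2])) hmin

end EdgeWeights

end FK

end Summit.CriticalPhenomena.PercolationContinuityZ3.Theorems

end
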